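import Summits.AnomalousDissipation.AnomalousDissipation.Theses.MomentParity
import Summits.AnomalousDissipation.AnomalousDissipation.Theorems.MomentParityGalerkinEnsembleRealization
import Summits.AnomalousDissipation.AnomalousDissipation.Theorems.ResolvedDissipation.Negative.KillShape
import Summits.AnomalousDissipation.AnomalousDissipation.Theorems.MomentParityResolvedDissipationInvariance

/-!
# `MomentParity.ResolvedDissipation` (stmt-AnomalousDissipation-14284), line `lh-energy-equality-bracket`:
# stub S2 `stub_limitLawDefect` — the shift-invariant limit law keeps the work–dissipation margin

Supports stmt-AnomalousDissipation-14284 (stub S2 of the line lead's skeleton; nothing here closes an item).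

Let `P_j` be shift-invariant probability laws on the compact metrizable trajectory space
`𝒦 = pathSpace R L` (`MomentParityDefs`, `compactSpace_pathSpace`) such that for all cutoffs `K ≤ j` the mean
resolved dissipation `∫ dissMean ν K dP_j` plus a fixed margin `η` is dominated by the mean window-`[0,1]` WORK
`∫ (∫₀¹ Σ'_k Re⟪𝓕f k, ω̄(t,k)⟫ dt) dP_j(ω)`. Then a subsequential weak limit `Q` (Prokhorov / Riesz:
`ProbabilityMeasure 𝒦` is compact metrizable) is a shift-invariant probability law with the same margin at EVERY
cutoff, and every neighbourhood of every point of `supp Q` is charged by `P_j` for arbitrarily large `j`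
(portmanteau on open sets).

This is `MomentParity.exists_shiftInvariant_limit` (stmt-AnomalousDissipation-11466) with two bounded continuous
functionals per cutoff instead of one: `dissMean ν K` (`continuous_dissMean`) and the work functional, which is
continuous on `𝒦` by the Weierstrass M-test (`continuous_workIntegrand`, `continuous_workMean`: each term
`(ω,t) ↦ Re⟪𝓕f k, ω̄(t,k)⟫` is jointly continuous, `‖ω̄(t,k)‖ ≤ |R|` on `𝒦`, and `Σ_k ‖𝓕f k‖ < ∞` for smooth `f`,
`Torus.summable_norm_mFourierCoeff_of_isSmooth`).

Sources: Foias–Rosa–Temam 2013 (arXiv:1111.6257) §3, proof of Thm. 3.1; Foias–Manley–Rosa–Temam 2001,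
Ch. IV App. B (time-average / generalised limits of Galerkin statistical solutions). [folklore compactness step]
-/

noncomputable section

set_option linter.dupNamespace false

namespace Summit.AnomalousDissipation.AnomalousDissipation.Theorems.MomentParityResolvedDissipation.LhBracket.LimitLawDefect

open MeasureTheory Filter Topology Set Function Metric UnitAddTorus
open scoped ENNReal InnerProductSpace RealInnerProductSpace BigOperators
open Literature.Analysis.FunctionSpaces Literature.Analysis.FunctionSpaces.Torus
open Literature.Analysis.FluidPDE Literature.Analysis.FluidPDE.Torus
open Summit.AnomalousDissipation.AnomalousDissipation.Theses.MomentParity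
open Summit.AnomalousDissipation.AnomalousDissipation.Theorems.MomentParity
open Summit.AnomalousDissipation.AnomalousDissipation.Theorems.QuarticGate.Negative
  (IsLevel IsBandTest polyGrad IsPolyStationary)
open Summit.AnomalousDissipation.AnomalousDissipation.Theorems

/-- **The work integrand is jointly continuous on `𝒦 × ℝ`.** The series
`(ω, t) ↦ Σ'_k Re⟪𝓕f k, ω̄(t,k)⟫` converges uniformly on `pathSpace R L × ℝ` (Weierstrass M-test with majorant
`‖𝓕f k‖ · |R|`: `norm_pathExt_le`, `Torus.summable_norm_mFourierCoeff_of_isSmooth`), and each term is continuous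
(`continuous_pathExt_subtype_prod`). -/
theorem continuous_workIntegrand {f : UnitAddTorus (Fin 3) → EuclideanSpace ℝ (Fin 3)} (hf : Torus.IsSmooth f)
    (R : ℝ) (L : (Fin 3 → ℤ) → ℝ) :
    Continuous fun p : ↥(pathSpace (d := Fin 3) R L) × ℝ => ∑' k : Fin 3 → ℤ,
      (inner ℂ (mFourierCoeff (EuclideanSpace.complexify ∘ f) k) (pathExt p.1.1 p.2 k)).re := by
  refine continuous_tsum (fun k => ?_)
    ((Torus.summable_norm_mFourierCoeff_of_isSmooth hf).mul_right |R|) (fun k p => ?_)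
  · exact Complex.continuous_re.comp (continuous_const.inner (continuous_pathExt_subtype_prod R L k))
  · rw [Real.norm_eq_abs]
    calc |(inner ℂ (mFourierCoeff (EuclideanSpace.complexify ∘ f) k) (pathExt p.1.1 p.2 k)).re|
        ≤ ‖inner ℂ (mFourierCoeff (EuclideanSpace.complexify ∘ f) k) (pathExt p.1.1 p.2 k)‖ :=
          Complex.abs_re_le_norm _
      _ ≤ ‖mFourierCoeff (EuclideanSpace.complexify ∘ f) k‖ * ‖pathExt p.1.1 p.2 k‖ := norm_inner_le_norm _ _
      _ ≤ ‖mFourierCoeff (EuclideanSpace.complexify ∘ f) k‖ * |R| :=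
          mul_le_mul_of_nonneg_left (norm_pathExt_le p.1.2 p.2 k) (norm_nonneg _)

/-- **The window-`[0,1]` work functional `ω ↦ ∫₀¹ Σ'_k Re⟪𝓕f k, ω̄(t,k)⟫ dt` is continuous on `𝒦`**
(a parametric interval integral of a jointly continuous integrand). -/
theorem continuous_workMean {f : UnitAddTorus (Fin 3) → EuclideanSpace ℝ (Fin 3)} (hf : Torus.IsSmooth f)
    (R : ℝ) (L : (Fin 3 → ℤ) → ℝ) :
    Continuous fun ω : ↥(pathSpace (d := Fin 3) R L) => ∫ t in (0 : ℝ)..1, ∑' k : Fin 3 → ℤ,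
      (inner ℂ (mFourierCoeff (EuclideanSpace.complexify ∘ f) k) (pathExt ω.1 t k)).re :=
  intervalIntegral.continuous_parametric_intervalIntegral_of_continuous' (continuous_workIntegrand hf R L) 0 1

/-- **S2 · `stub_limitLawDefect` — compactness with a margin.** Let `P_j` be shift-invariant probability laws on
the (compact metrizable) trajectory space `𝒦 = pathSpace R L` such that for all cutoffs `K ≤ j` the mean resolved
dissipation `∫ dissMean ν K dP_j` plus a fixed margin `η` is dominated by the mean window-`[0,1]` work. Then some
shift-invariant probability law `Q` on `𝒦` has the same margin at EVERY cutoff, and every neighbourhood of every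
point of `supp Q` is charged by `P_j` for arbitrarily large `j`.
PROOF: `exists_shiftInvariant_limit` verbatim (subsequence limit in `ProbabilityMeasure 𝒦` by
`CompactSpace.tendsto_subseq`; shift invariance by `ProbabilityMeasure.tendsto_map_of_tendsto_of_continuous` and
uniqueness of limits; the support clause by the portmanteau inequality on open sets), with two bounded continuous
functionals per cutoff: `dissMean ν K` (`continuous_dissMean`) and the work functional (`continuous_workMean`);
for fixed `K` the inequality holds for all `j ≥ K`, hence eventually along the subsequence, hence in the limit
(`le_of_tendsto_of_tendsto`). [folklore; FoiasRosaTemam2013 §3; FMRTTurbulence2001 Ch. IV App. B] -/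
theorem stub_limitLawDefect :
    ∀ (f : UnitAddTorus (Fin 3) → EuclideanSpace ℝ (Fin 3)), Torus.IsSmooth f →
    ∀ (R : ℝ) (L : (Fin 3 → ℤ) → ℝ) (ν η : ℝ)
      (P : ℕ → Measure ↥(pathSpace (d := Fin 3) R L)), (∀ j, IsProbabilityMeasure (P j)) →
      (∀ j, (P j).map (pathShiftOn R L (pathShift_mapsTo R L)) = P j) →
      (∀ j K : ℕ, K ≤ j →
        (∫ ω, dissMean ν K ω.1 ∂(P j)) + η ≤
          ∫ ω, (∫ t in (0 : ℝ)..1, ∑' k : Fin 3 → ℤ,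
            (inner ℂ (mFourierCoeff (EuclideanSpace.complexify ∘ f) k) (pathExt ω.1 t k)).re) ∂(P j)) →
    ∃ Q : Measure ↥(pathSpace (d := Fin 3) R L), IsProbabilityMeasure Q ∧
      Q.map (pathShiftOn R L (pathShift_mapsTo R L)) = Q ∧
      (∀ K : ℕ, (∫ ω, dissMean ν K ω.1 ∂Q) + η ≤
          ∫ ω, (∫ t in (0 : ℝ)..1, ∑' k : Fin 3 → ℤ,
            (inner ℂ (mFourierCoeff (EuclideanSpace.complexify ∘ f) k) (pathExt ω.1 t k)).re) ∂Q) ∧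
      ∀ ω ∈ Q.support, ∀ U ∈ 𝓝 ω, ∀ i : ℕ, ∃ j, i ≤ j ∧ 0 < P j U := by
  intro f hf R L ν η P hP hθ hmargin
  haveI : CompactSpace ↥(pathSpace (d := Fin 3) R L) := compactSpace_pathSpace R L
  -- the sequence in the compact metrizable space of probability measures
  set μs : ℕ → ProbabilityMeasure ↥(pathSpace (d := Fin 3) R L) := fun j => ⟨P j, hP j⟩ with hμs
  obtain ⟨Qp, φ, hφ, hlim'⟩ := CompactSpace.tendsto_subseq μs
  have hlim : Tendsto (fun i => μs (φ i)) atTop (𝓝 Qp) := hlim'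
  refine ⟨Qp.toMeasure, inferInstance, ?_, ?_, ?_⟩
  · -- shift invariance passes to the limit
    have hc : Continuous (pathShiftOn (d := Fin 3) R L (pathShift_mapsTo R L)) := continuous_pathShiftOn R L
    have h1 := ProbabilityMeasure.tendsto_map_of_tendsto_of_continuous _ _ hlim hc
    have h2 : (fun i => (μs (φ i)).map hc.measurable.aemeasurable) = fun i => μs (φ i) := by
      funext i
      apply ProbabilityMeasure.toMeasure_injective
      rw [ProbabilityMeasure.toMeasure_map]
      exact hθ (φ i)
    rw [h2] at h1
    have h3 := tendsto_nhds_unique h1 hlim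
    have h4 := congrArg ProbabilityMeasure.toMeasure h3
    rw [ProbabilityMeasure.toMeasure_map] at h4
    exact h4
  · -- the margin at every cutoff: two bounded continuous functionals, the inequality holds eventually
    intro K
    set Fd : BoundedContinuousFunction ↥(pathSpace (d := Fin 3) R L) ℝ :=
      BoundedContinuousFunction.mkOfCompact ⟨fun ω => dissMean ν K ω.1, continuous_dissMean R L ν K⟩ with hFd
    set Fw : BoundedContinuousFunction ↥(pathSpace (d := Fin 3) R L) ℝ :=
      BoundedContinuousFunction.mkOfCompact ⟨fun ω => ∫ t in (0 : ℝ)..1, ∑' k : Fin 3 → ℤ,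
        (inner ℂ (mFourierCoeff (EuclideanSpace.complexify ∘ f) k) (pathExt ω.1 t k)).re,
        continuous_workMean hf R L⟩ with hFw
    have hd := (ProbabilityMeasure.tendsto_iff_forall_integral_tendsto.1 hlim) Fd
    have hw := (ProbabilityMeasure.tendsto_iff_forall_integral_tendsto.1 hlim) Fw
    refine le_of_tendsto_of_tendsto (hd.add_const η) hw ?_
    filter_upwards [eventually_ge_atTop K] with i hi
    exact hmargin (φ i) K (hi.trans (hφ.id_le i))
  · -- the support is charged by the approximations (portmanteau on open sets)
    intro ω hω U hU i
    obtain ⟨V, hVU, hVo, hωV⟩ := mem_nhds_iff.1 hU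
    have hpos : 0 < Qp.toMeasure V := (Measure.mem_support_iff_forall ω).1 hω V (hVo.mem_nhds hωV)
    have hlim_inf := ProbabilityMeasure.le_liminf_measure_open_of_tendsto hlim hVo
    have hfreq : ∃ᶠ n in atTop, 0 < (μs (φ n) : Measure _) V := by
      by_contra hcon
      rw [not_frequently] at hcon
      have h0 : liminf (fun n => (μs (φ n) : Measure _) V) atTop = 0 := by
        refine Filter.Tendsto.liminf_eq ?_
        refine tendsto_const_nhds.congr' ?_
        filter_upwards [hcon] with n hn
        exact (le_zero_iff.1 (not_lt.1 hn)).symm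
      rw [h0] at hlim_inf
      exact absurd hlim_inf (not_le.2 hpos)
    obtain ⟨n, hnpos, hn⟩ := (hfreq.and_eventually (eventually_ge_atTop i)).exists
    exact ⟨φ n, hn.trans (hφ.id_le n), hnpos.trans_le (measure_mono hVU)⟩

end Summit.AnomalousDissipation.AnomalousDissipation.Theorems.MomentParityResolvedDissipation.LhBracket.LimitLawDefect
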